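import Mathlib.NumberTheory.NumberField.InfinitePlace.Embeddings
import Mathlib.NumberTheory.NumberField.Basic
import Mathlib.RingTheory.DedekindDomain.AdicValuation
import Mathlib.Data.Fintype.Pigeonhole
import Mathlib.GroupTheory.OrderOfElement
import HarnessLib

/-!
# A non-zero element of a number field that has `n`-th roots for every `n ≥ 1` equals `1`

Classical.  For a number field `K` and `a ∈ K^×`: if for every `n ≥ 1` there is `b ∈ K` with `b ^ n = a`, then
`a = 1`.  Proof: (1) at every finite place `v` the integer `v(a)` is divisible by every `n`, hence `0`, so `a`
is an algebraic integer (Dedekind: `HeightOneSpectrum.mem_integers_of_valuation_le_one`), and so is each root `b`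
(`IsIntegral.of_pow`); (2) every complex conjugate of a root `b` of `a` has absolute value at most
`max 1 (max_φ |φ a|)`, so by Northcott (`NumberField.Embeddings.finite_of_norm_le`) the roots range over a FINITE
set and two of them coincide: `b ^ n = a = b ^ m` with `n ≠ m`, whence `a` is a root of unity; (3) the roots of
unity of `K` form a finite set (Northcott again), so for `N :=` the product of their orders the `N`-th root `b` of
`a` is itself a root of unity (`b ^ (N t) = 1`) with `b ^ N = 1`, i.e. `a = 1`.

Motivation (cell abc-iut, [IUTchI] Example 5.1 (v), layer-5 certificate v0.5 `layer5_held_ex51v_v5_fieldLevel`,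
abc-iut-w4-d056's field-level Kummer law `hdiv`): "no nonzero rational function other than `1` fixed by an open normal
subgroup `H` of `π₁^rat` has `H`-fixed `n`-th roots for all `n`" — at the Galois toy `K_rat := ℚ̄`, `π₁^rat := G_ℚ`
the fixed field of an open subgroup is a number field and the law is exactly this lemma.  No IUT content here;
theorem-only file (no definition, no named fact), classical, unconditional, Mathlib vocabulary (`NumberField`,
`IsDedekindDomain.HeightOneSpectrum`, `NumberField.Embeddings`).

## References

* J. Neukirch, *Algebraic Number Theory* (1999) [NeukirchANT1999]: Ch. I §7 (Dirichlet's unit theorem, incl. the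
  finiteness of the group `μ(K)` of roots of unity — the lemma is an immediate corollary: `K^× ⊇ 𝒪_K^× ≅ μ(K) × ℤ^{r+s-1}`
  has no non-trivial infinitely divisible element, and an infinitely divisible element is a unit at every finite
  place) and Ch. I §11 (localisation: `𝒪_K = ⋂_𝔭 𝒪_{K,𝔭}`, the valuative characterisation of the integers).  The
  proof given here replaces the unit theorem by Northcott's finiteness (Mathlib `NumberField.Embeddings.finite_of_norm_le`).
-/

namespace Literature.NumberTheory.NumberFields

open NumberField Polynomial

/-- An integer divisible by every positive natural number is `0`. (Elementary helper.) [folklore] -/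
private theorem Int.eq_zero_of_forall_dvd {k : ℤ} (h : ∀ n : ℕ, 0 < n → (n : ℤ) ∣ k) : k = 0 := by
  by_contra hk
  obtain ⟨c, hc⟩ := h (k.natAbs + 1) (Nat.succ_pos _)
  rcases eq_or_ne c 0 with rfl | hc0
  · exact hk (by simpa using hc)
  · have h1 := congrArg Int.natAbs hc
    rw [Int.natAbs_mul, Int.natAbs_natCast] at h1
    have hc1 : 1 ≤ c.natAbs := Int.natAbs_pos.2 hc0
    have h2 : (k.natAbs + 1) * 1 ≤ (k.natAbs + 1) * c.natAbs := Nat.mul_le_mul_left _ hc1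
    omega

variable {K : Type*} [Field K] [NumberField K]

/-- A non-zero element of a number field with `n`-th roots for all `n ≥ 1` is an ALGEBRAIC INTEGER: at every finite
place its (additive) valuation is divisible by every `n`, hence zero, and `𝒪_K = ⋂_𝔭 𝒪_{K,𝔭}`.
[cite: NeukirchANT1999, Ch. I §11] -/
theorem isIntegral_of_forall_exists_pow_eq {a : K} (ha : a ≠ 0) (h : ∀ n : ℕ, 0 < n → ∃ b : K, b ^ n = a) :
    IsIntegral ℤ a := by
  have hle : ∀ v : IsDedekindDomain.HeightOneSpectrum (𝓞 K), v.valuation K a ≤ 1 := by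
    intro v
    have hva : v.valuation K a ≠ 0 := (Valuation.ne_zero_iff _).2 ha
    -- write `v(a) = ofAdd k`
    set k : ℤ := Multiplicative.toAdd (WithZero.unzero hva) with hk
    have hka : v.valuation K a = ((Multiplicative.ofAdd k : Multiplicative ℤ) : WithZero (Multiplicative ℤ)) := by
      rw [hk, ofAdd_toAdd, WithZero.coe_unzero]
    -- `k` is divisible by every `n`
    have hdvd : ∀ n : ℕ, 0 < n → (n : ℤ) ∣ k := by
      intro n hn
      obtain ⟨b, hb⟩ := h n hn
      have hb0 : b ≠ 0 := by
        rintro rfl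
        rw [zero_pow hn.ne'] at hb
        exact ha hb.symm
      have hvb : v.valuation K b ≠ 0 := (Valuation.ne_zero_iff _).2 hb0
      set j : ℤ := Multiplicative.toAdd (WithZero.unzero hvb) with hj
      have hjb : v.valuation K b = ((Multiplicative.ofAdd j : Multiplicative ℤ) : WithZero (Multiplicative ℤ)) := by
        rw [hj, ofAdd_toAdd, WithZero.coe_unzero]
      have hpow : v.valuation K a = (v.valuation K b) ^ n := by rw [← map_pow, hb]
      rw [hka, hjb, ← WithZero.coe_pow, WithZero.coe_inj, ← ofAdd_nsmul] at hpow
      have hk' : k = n • j := Multiplicative.ofAdd.injective hpow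
      exact ⟨j, by rw [hk', nsmul_eq_mul]⟩
    have hk0 : k = 0 := Int.eq_zero_of_forall_dvd hdvd
    rw [hka, hk0, ofAdd_zero, WithZero.coe_one]
  obtain ⟨x, hx⟩ := IsDedekindDomain.HeightOneSpectrum.mem_integers_of_valuation_le_one K a hle
  rw [← hx]
  exact RingOfIntegers.isIntegral_coe x

/-- A non-zero element of a number field with `n`-th roots for all `n ≥ 1` is a ROOT OF UNITY: its roots are
algebraic integers with bounded conjugates, so by Northcott two of them coincide (corollary of Dirichlet's unit
theorem; proved here via Northcott). [cite: NeukirchANT1999, Ch. I §7] -/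
theorem exists_pow_eq_one_of_forall_exists_pow_eq {a : K} (ha : a ≠ 0)
    (h : ∀ n : ℕ, 0 < n → ∃ b : K, b ^ n = a) : ∃ t : ℕ, 0 < t ∧ a ^ t = 1 := by
  classical
  have hint : IsIntegral ℤ a := isIntegral_of_forall_exists_pow_eq ha h
  -- the bound on conjugates of roots
  let B : ℝ := max 1 (∑ φ : K →+* ℂ, ‖φ a‖)
  have hBa : ∀ φ : K →+* ℂ, ‖φ a‖ ≤ B := fun φ =>
    le_trans (Finset.single_le_sum (f := fun φ : K →+* ℂ => ‖φ a‖) (fun _ _ => norm_nonneg _)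
      (Finset.mem_univ φ)) (le_max_right _ _)
  have hB1 : 1 ≤ B := le_max_left _ _
  -- the finite Northcott set
  have hfin : {x : K | IsIntegral ℤ x ∧ ∀ φ : K →+* ℂ, ‖φ x‖ ≤ B}.Finite :=
    NumberField.Embeddings.finite_of_norm_le K ℂ B
  -- every root of `a` lies in it
  have hroot : ∀ (n : ℕ) (b : K), 0 < n → b ^ n = a →
      b ∈ {x : K | IsIntegral ℤ x ∧ ∀ φ : K →+* ℂ, ‖φ x‖ ≤ B} := by
    intro n b hn hb
    refine ⟨IsIntegral.of_pow hn (hb ▸ hint), fun φ => ?_⟩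
    by_contra hlt
    rw [not_le] at hlt
    have h1 : 1 ≤ ‖φ b‖ := le_trans hB1 hlt.le
    have : B < ‖φ a‖ := by
      calc B < ‖φ b‖ := hlt
        _ ≤ ‖φ b‖ ^ n := le_self_pow₀ h1 hn.ne'
        _ = ‖φ a‖ := by rw [← norm_pow, ← map_pow, hb]
    exact absurd (hBa φ) (not_le.2 this)
  -- choose a root of each order `n + 1`
  choose b hb using fun n : ℕ => h (n + 1) (Nat.succ_pos n)
  haveI : Finite {x : K | IsIntegral ℤ x ∧ ∀ φ : K →+* ℂ, ‖φ x‖ ≤ B} := hfin.to_subtype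
  let f : ℕ → {x : K | IsIntegral ℤ x ∧ ∀ φ : K →+* ℂ, ‖φ x‖ ≤ B} :=
    fun n => ⟨b n, hroot (n + 1) (b n) (Nat.succ_pos n) (hb n)⟩
  obtain ⟨n, m, hnm, hfnm⟩ := Finite.exists_ne_map_eq_of_infinite f
  have hbnm : b n = b m := congrArg Subtype.val hfnm
  -- `c ^ (n+1) = a = c ^ (m+1)` with `n ≠ m`, `c := b n`
  have hcn : b n ^ (n + 1) = a := hb n
  have hcm : b n ^ (m + 1) = a := by rw [hbnm]; exact hb m
  have hc0 : b n ≠ 0 := by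
    intro h0
    rw [h0, zero_pow (Nat.succ_ne_zero n)] at hcn
    exact ha hcn.symm
  -- wlog `n < m`
  rcases Nat.lt_or_gt_of_ne hnm with hlt | hlt
  · refine ⟨m - n, Nat.sub_pos_of_lt hlt, ?_⟩
    have hcd : b n ^ (m - n) = 1 := by
      have : b n ^ (m + 1) = b n ^ (n + 1) * b n ^ (m - n) := by rw [← pow_add]; congr 1; omega
      rw [hcm, ← hcn, eq_comm, mul_eq_left₀ (pow_ne_zero _ hc0)] at this
      exact this
    rw [← hcn, ← pow_mul, mul_comm, pow_mul, hcd, one_pow]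
  · refine ⟨n - m, Nat.sub_pos_of_lt hlt, ?_⟩
    have hcd : b n ^ (n - m) = 1 := by
      have : b n ^ (n + 1) = b n ^ (m + 1) * b n ^ (n - m) := by rw [← pow_add]; congr 1; omega
      rw [hcn, ← hcm, eq_comm, mul_eq_left₀ (pow_ne_zero _ hc0)] at this
      exact this
    rw [← hcm, ← pow_mul, mul_comm, pow_mul, hcd, one_pow]

/-- **A non-zero element of a number field that has `n`-th roots for every `n ≥ 1` is `1`** (corollary of
Dirichlet's unit theorem and the finiteness of `μ(K)`; proved here via Northcott: the roots of unity of `K` form a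
finite set and the `N`-th root of `a`, `N` the product of their orders, is one of them).
[cite: NeukirchANT1999, Ch. I §7] -/
theorem eq_one_of_forall_exists_pow_eq {a : K} (ha : a ≠ 0) (h : ∀ n : ℕ, 0 < n → ∃ b : K, b ^ n = a) :
    a = 1 := by
  classical
  obtain ⟨t, ht, hat⟩ := exists_pow_eq_one_of_forall_exists_pow_eq ha h
  -- the set of roots of unity is finite
  let R : Set K := {x : K | ∃ s : ℕ, 0 < s ∧ x ^ s = 1}
  have hRfin : R.Finite := by
    refine (NumberField.Embeddings.finite_of_norm_le K ℂ 1).subset ?_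
    rintro x ⟨s, hs, hxs⟩
    refine ⟨IsIntegral.of_pow hs (by rw [hxs]; exact isIntegral_one), fun φ => ?_⟩
    have h1 : ‖φ x‖ ^ s = 1 := by rw [← norm_pow, ← map_pow, hxs, map_one, norm_one]
    exact (pow_eq_one_iff_of_nonneg (norm_nonneg _) hs.ne').1 h1 |>.le
  -- `N :=` the product of the orders of the roots of unity kills every one of them
  let N : ℕ := ∏ x ∈ hRfin.toFinset, orderOf x
  have hN : 0 < N := by
    refine Finset.prod_pos fun x hx => ?_
    obtain ⟨s, hs, hxs⟩ := hRfin.mem_toFinset.1 hx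
    exact IsOfFinOrder.orderOf_pos (isOfFinOrder_iff_pow_eq_one.2 ⟨s, hs, hxs⟩)
  have hkill : ∀ x ∈ R, x ^ N = 1 := by
    intro x hx
    exact orderOf_dvd_iff_pow_eq_one.1 (Finset.dvd_prod_of_mem _ (hRfin.mem_toFinset.2 hx))
  -- the `N`-th root of `a` is a root of unity, hence killed by `N`
  obtain ⟨b, hb⟩ := h N hN
  have hbR : b ∈ R := ⟨N * t, Nat.mul_pos hN ht, by rw [pow_mul, hb, hat]⟩
  rw [← hb, hkill b hbR]

end Literature.NumberTheory.NumberFields
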